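import Summits.CriticalPhenomena.Ising3DConformalLimit.Theorems.HyperoctahedralRPExistsScaleCovariantLimitFoldedCurrentTwoPointImageScaleCovariant
import Summits.CriticalPhenomena.Ising3DConformalLimit.Theses.ClusterRigidity
import HarnessLib

/-!
# F4' unconditionally: item 4659 forces EXACT SCALE COVARIANCE of every cluster point, at all orders
# (crux `ExistsScaleCovariantLimit`, item stmt-CriticalPhenomena-1981, line `folded-current-repulsion`; lead c18)

Route `HyperoctahedralRP` / `PositivityBegetsConformality` (sub-problem `CriticalPhenomena/Ising3DConformalLimit`). The line's stub
F4' is item stmt-CriticalPhenomena-4659 `ClusterRigidity.ClusterSetTotallyDisconnected` verbatim: the set `𝒞` of cluster points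
(along mesh sequences `u_k → 0⁺` in `(0,1]`, all orders, locally uniformly off the diagonals, normalised to `0` on them) of the
self-normalised critical `ℤ³` Ising correlators is totally disconnected in the product topology of `CorrFamily 3`. The crux is
`6150 ∧ 4659` (`crux_iff_doubling_and_totallyDisconnected`), where 4659 was read as the "identification half", toothless without
the compactness item 6150. This file shows that 4659 ALONE already has teeth, with no compactness input:

* `dilate_pin_mem_clusterSet`, `continuousOn_dilate_pin` — the re-pinned dilation flow `D_s S = (S₂(0, s e₀)^{-n/2} S_n(s ·))_n`
  keeps `𝒞` invariant (`isClusterPoint_dilate_pin`, companion file) and `s ↦ D_s S` is continuous from `(0,∞)` into the product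
  topology (continuity of cluster points off the diagonals; they vanish on them);
* `dilate_pin_eq_self_of_clusterSetTotallyDisconnected` — **item 4659 ⟹ `D_s S = S` for every `S ∈ 𝒞` and every `s > 0`**
  (the orbit is a connected subset of a totally disconnected set through `S = D_1 S`);
* `exists_rpow_of_mul_of_continuousOn` — a positive continuous multiplicative function on `(0,∞)` is a real power (Cauchy's
  equation, `AddMonoidHom.map_real_smul`);
* **`isScaleCovariant_of_clusterSetTotallyDisconnected` — item 4659 ⟹ every `S ∈ 𝒞` is EXACTLY SCALE COVARIANT,
  `IsScaleCovariant Δ_S S` with `0 ≤ Δ_S`** (the axis profile `s ↦ S₂(0, s e₀)` is multiplicative by the previous item,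
  continuous, positive, `≤ 1` beyond `s = 1`, hence `s^{-2Δ_S}` with `Δ_S ≥ 0`, and `D_s S = S` reads
  `S_n(s x) = s^{-nΔ_S} S_n(x)`);
* `cruxClauses_of_clusterSetTotallyDisconnected` — hence under item 4659 every cluster point satisfies every clause the crux asks of
  its limit `S` except being THE full-filter limit (normalised, `IsNondegenerateTwoPoint`, `IsTranslationInvariant`,
  `IsScaleCovariant Δ` — with `0 ≤ Δ` in place of `0 < Δ`).

Reading (planners / item 4659's chain): 4659 is a scale-covariance RIGIDITY statement about each cluster point separately; what it
leaves to item 6150 is only the existence of cluster points along every mesh sequence and their coincidence. No definitions; no `sorry`.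

References: H. Duminil-Copin, ICM 2022, §8.1 eq. (8.1)–(8.2), §8.4 [DuminilCopinICM2022]; P. Di Francesco, P. Mathieu, D. Sénéchal,
*Conformal Field Theory* (1997) §4.3.1 (scale covariance of correlation families) [FrancescoMathieuSenechal1997].
-/

noncomputable section

namespace Summit.CriticalPhenomena.Ising3DConformalLimit.Cruxes.ExistsScaleCovariantLimit.FoldedCurrentRepulsion

open Filter Set
open scoped Topology
open Literature.Probability.LatticeModels
open Summit.CriticalPhenomena.Ising3DConformalLimit.MoebiusLimitExistsOnlyInteraction
  (rhoPin IsClusterPoint rhoPin_pos smul_mapsTo_nonCoincident_sc)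
open Summit.CriticalPhenomena.Ising3DConformalLimit.MoebiusLimitExistsNegative (clusterPoint_two_conv)
open Summit.CriticalPhenomena.Ising3DConformalLimit.ReflectionTwinExistsContinuousLimit (clusterPoint_nondeg_two)
open Summit.CriticalPhenomena.Ising3DConformalLimit.ExistsScaleCovariantLimitNegative.Dyadic
  (pz_scale cfg0_mem smul_cfg01 pz_two_cfg0_le_one)
open Summit.CriticalPhenomena.Ising3DConformalLimit.PinnedClusterPoints (cfg01_mem clusterPoint_cfg01)
open Summit.CriticalPhenomena.Ising3DConformalLimit.Cruxes.ExistsScaleCovariantLimit.TwoHierarchies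
  (continuousOn_of_isClusterPoint smul_cfg0 seqLimit_translate)
open Summit.CriticalPhenomena.Ising3DConformalLimit.Theses

/-! ## §1 The re-pinned dilation flow on item 4659's set -/

/-- Item 4659's set is invariant under the re-pinned dilations `D_s`, `s > 0`. [folklore] -/
theorem dilate_pin_mem_clusterSet {S : CorrFamily 3}
    (hS : S ∈ {S : CorrFamily 3 | (∀ n x, x ∉ NonCoincident 3 n → S n x = 0) ∧
      ∃ u : ℕ → ℝ, (∀ k, u k ∈ Set.Ioc (0:ℝ) 1) ∧ Filter.Tendsto u Filter.atTop (nhds 0) ∧ ∀ n, TendstoLocallyUniformlyOn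
        (fun k => rescaledCorrelator (criticalCorr 3) (fun δ : ℝ => (criticalTwoPoint 3 (Pi.single 0 ⌊δ⁻¹⌋)) ^ (-(1/2:ℝ))) n (u k))
        (S n) Filter.atTop (NonCoincident 3 n)}) {s : ℝ} (hs : 0 < s) :
    ((fun (n : ℕ) (x : Fin n → EuclideanSpace ℝ (Fin 3)) =>
      (S 2 (![0, EuclideanSpace.single 0 s] : Fin 2 → EuclideanSpace ℝ (Fin 3))) ^ (-(n:ℝ) / 2) * S n (fun i => s • x i)) : CorrFamily 3) ∈
      {S : CorrFamily 3 | (∀ n x, x ∉ NonCoincident 3 n → S n x = 0) ∧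
      ∃ u : ℕ → ℝ, (∀ k, u k ∈ Set.Ioc (0:ℝ) 1) ∧ Filter.Tendsto u Filter.atTop (nhds 0) ∧ ∀ n, TendstoLocallyUniformlyOn
        (fun k => rescaledCorrelator (criticalCorr 3) (fun δ : ℝ => (criticalTwoPoint 3 (Pi.single 0 ⌊δ⁻¹⌋)) ^ (-(1/2:ℝ))) n (u k))
        (S n) Filter.atTop (NonCoincident 3 n)} :=
  mem_clusterSet_of_isClusterPoint (isClusterPoint_dilate_pin (isClusterPoint_of_mem_clusterSet hS) hs)
    (dilate_pin_normalised hS.1 hs)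

/-- The orbit `s ↦ D_s S` of a member of item 4659's set is continuous from `(0,∞)` into the product topology of `CorrFamily 3`.
[folklore] -/
theorem continuousOn_dilate_pin {S : CorrFamily 3}
    (hS : S ∈ {S : CorrFamily 3 | (∀ n x, x ∉ NonCoincident 3 n → S n x = 0) ∧
      ∃ u : ℕ → ℝ, (∀ k, u k ∈ Set.Ioc (0:ℝ) 1) ∧ Filter.Tendsto u Filter.atTop (nhds 0) ∧ ∀ n, TendstoLocallyUniformlyOn
        (fun k => rescaledCorrelator (criticalCorr 3) (fun δ : ℝ => (criticalTwoPoint 3 (Pi.single 0 ⌊δ⁻¹⌋)) ^ (-(1/2:ℝ))) n (u k))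
        (S n) Filter.atTop (NonCoincident 3 n)}) :
    ContinuousOn (fun (s : ℝ) (n : ℕ) (x : Fin n → EuclideanSpace ℝ (Fin 3)) =>
      (S 2 (![0, EuclideanSpace.single 0 s] : Fin 2 → EuclideanSpace ℝ (Fin 3))) ^ (-(n:ℝ) / 2) * S n (fun i => s • x i))
      (Set.Ioi 0) := by
  have hSn : ∀ n x, x ∉ NonCoincident 3 n → S n x = 0 := hS.1
  have hcp : IsClusterPoint S := isClusterPoint_of_mem_clusterSet hS
  have hcont := continuousOn_of_isClusterPoint hcp
  have hψpos : ∀ {s : ℝ}, 0 < s → 0 < S 2 (![0, EuclideanSpace.single 0 s] : Fin 2 → EuclideanSpace ℝ (Fin 3)) :=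
    fun {s} hs => clusterPoint_nondeg_two (clusterPoint_two_conv hcp) _ (cfg0_mem hs.ne')
  have hψcont : ContinuousOn (fun s : ℝ => S 2 (![0, EuclideanSpace.single 0 s] : Fin 2 → EuclideanSpace ℝ (Fin 3))) (Set.Ioi 0) := by
    have h := (hcont 2).comp (continuous_smul_cfg (![0, EuclideanSpace.single 0 1] : Fin 2 → EuclideanSpace ℝ (Fin 3))).continuousOn
      (fun s (hs : s ∈ Set.Ioi (0:ℝ)) => smul_mapsTo_nonCoincident_sc (ne_of_gt hs) 2 cfg01_mem)
    refine h.congr fun s _ => ?_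
    simp only [Function.comp_apply, smul_cfg01]
  refine continuousOn_pi.2 fun n => continuousOn_pi.2 fun y => ?_
  have hfac : ContinuousOn (fun s : ℝ => (S 2 (![0, EuclideanSpace.single 0 s] : Fin 2 → EuclideanSpace ℝ (Fin 3))) ^ (-(n:ℝ) / 2))
      (Set.Ioi 0) :=
    hψcont.rpow_const fun s hs => Or.inl (hψpos hs).ne'
  by_cases hy : y ∈ NonCoincident 3 n
  · exact hfac.mul ((hcont n).comp (continuous_smul_cfg y).continuousOn
      (fun s (hs : s ∈ Set.Ioi (0:ℝ)) => smul_mapsTo_nonCoincident_sc (ne_of_gt hs) n hy))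
  · exact hfac.mul ((continuousOn_const (c := (0:ℝ))).congr fun s (hs : s ∈ Set.Ioi (0:ℝ)) =>
      hSn n _ (smul_not_mem_nonCoincident (ne_of_gt hs) hy))

/-- **Item 4659 ⟹ every member of its set is a FIXED POINT of the re-pinned dilation flow**: `D_s S = S` for all `s > 0`
(the orbit `{D_s S : s > 0}` is a connected subset of the totally disconnected set through `D_1 S = S`). [folklore] -/
theorem dilate_pin_eq_self_of_clusterSetTotallyDisconnected (htd : ClusterRigidity.ClusterSetTotallyDisconnected) {S : CorrFamily 3}
    (hS : S ∈ {S : CorrFamily 3 | (∀ n x, x ∉ NonCoincident 3 n → S n x = 0) ∧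
      ∃ u : ℕ → ℝ, (∀ k, u k ∈ Set.Ioc (0:ℝ) 1) ∧ Filter.Tendsto u Filter.atTop (nhds 0) ∧ ∀ n, TendstoLocallyUniformlyOn
        (fun k => rescaledCorrelator (criticalCorr 3) (fun δ : ℝ => (criticalTwoPoint 3 (Pi.single 0 ⌊δ⁻¹⌋)) ^ (-(1/2:ℝ))) n (u k))
        (S n) Filter.atTop (NonCoincident 3 n)}) {s : ℝ} (hs : 0 < s) :
    ((fun (n : ℕ) (x : Fin n → EuclideanSpace ℝ (Fin 3)) =>
      (S 2 (![0, EuclideanSpace.single 0 s] : Fin 2 → EuclideanSpace ℝ (Fin 3))) ^ (-(n:ℝ) / 2) * S n (fun i => s • x i)) : CorrFamily 3) =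
      S := by
  have hcp : IsClusterPoint S := isClusterPoint_of_mem_clusterSet hS
  set γ : ℝ → CorrFamily 3 := fun s n x =>
    (S 2 (![0, EuclideanSpace.single 0 s] : Fin 2 → EuclideanSpace ℝ (Fin 3))) ^ (-(n:ℝ) / 2) * S n (fun i => s • x i) with hγ
  have hsub : (γ '' Set.Ioi 0).Subsingleton :=
    htd _ (by rintro _ ⟨t, ht, rfl⟩; exact dilate_pin_mem_clusterSet hS ht)
      (isPreconnected_Ioi.image γ (continuousOn_dilate_pin hS))
  have h1 : γ 1 = S := by
    funext n x
    show (S 2 (![0, EuclideanSpace.single 0 1] : Fin 2 → EuclideanSpace ℝ (Fin 3))) ^ (-(n:ℝ) / 2) *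
      S n (fun i => (1:ℝ) • x i) = S n x
    rw [clusterPoint_cfg01 hcp, Real.one_rpow, one_mul]
    simp only [one_smul]
  have h := hsub ⟨s, Set.mem_Ioi.2 hs, rfl⟩ ⟨1, Set.mem_Ioi.2 one_pos, rfl⟩
  rw [h1] at h
  exact h

/-! ## §2 Cauchy's equation: a positive continuous multiplicative function on `(0,∞)` is a power -/

/-- A function `ψ : ℝ → ℝ`, positive, continuous and multiplicative on `(0,∞)`, is a real power there: `ψ c = c ^ e`.
(`t ↦ log ψ(eᵗ)` is a continuous additive self-map of `ℝ`, hence `ℝ`-linear, `AddMonoidHom.map_real_smul`.) [folklore] -/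
theorem exists_rpow_of_mul_of_continuousOn {ψ : ℝ → ℝ} (hpos : ∀ s, 0 < s → 0 < ψ s) (hcont : ContinuousOn ψ (Set.Ioi 0))
    (hmul : ∀ a b, 0 < a → 0 < b → ψ (a * b) = ψ a * ψ b) : ∃ e : ℝ, ∀ c, 0 < c → ψ c = c ^ e := by
  have hψ1 : ψ 1 = 1 := by
    have h := hmul 1 1 one_pos one_pos
    rw [one_mul] at h
    have h' : ψ 1 * (ψ 1 - 1) = 0 := by rw [mul_sub, mul_one, ← h, sub_self]
    rcases mul_eq_zero.1 h' with h0 | h0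
    · exact absurd h0 (hpos 1 one_pos).ne'
    · linarith
  set φ : ℝ →+ ℝ :=
    { toFun := fun t => Real.log (ψ (Real.exp t))
      map_zero' := by
        show Real.log (ψ (Real.exp 0)) = 0
        rw [Real.exp_zero, hψ1, Real.log_one]
      map_add' := fun a b => by
        show Real.log (ψ (Real.exp (a + b))) = Real.log (ψ (Real.exp a)) + Real.log (ψ (Real.exp b))
        rw [Real.exp_add, hmul _ _ (Real.exp_pos a) (Real.exp_pos b),
          Real.log_mul (hpos _ (Real.exp_pos a)).ne' (hpos _ (Real.exp_pos b)).ne'] } with hφ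
  have hφcont : Continuous φ := by
    have h1 : Continuous fun t : ℝ => ψ (Real.exp t) :=
      hcont.comp_continuous Real.continuous_exp fun t => Real.exp_pos t
    exact Real.continuousOn_log.comp_continuous h1 fun t => (hpos _ (Real.exp_pos t)).ne'
  refine ⟨φ 1, fun c hc => ?_⟩
  have hlin : φ (Real.log c) = Real.log c * φ 1 := by
    have h := map_real_smul φ hφcont (Real.log c) 1
    rw [smul_eq_mul, mul_one, smul_eq_mul] at h
    exact h
  have h' : φ (Real.log c) = Real.log (ψ (Real.exp (Real.log c))) := rfl
  rw [Real.exp_log hc] at h'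
  rw [Real.rpow_def_of_pos hc, ← hlin, h', Real.exp_log (hpos c hc)]

/-! ## §3 Item 4659 ⟹ exact scale covariance of every cluster point -/

/-- **ITEM 4659 ⟹ EVERY MEMBER OF ITS SET IS EXACTLY SCALE COVARIANT**, `IsScaleCovariant Δ_S S` with `0 ≤ Δ_S`, with no
compactness input. From `D_c S = S` (`dilate_pin_eq_self_of_clusterSetTotallyDisconnected`): at order two and the axis pairs the
profile `ψ(c) = S₂(0, c e₀)` is multiplicative, it is continuous and positive, hence `ψ(c) = c^{e}`
(`exists_rpow_of_mul_of_continuousOn`) with `e ≤ 0` (`ψ(2) ≤ 1`, the limit of `pz_two_cfg0_le_one`); then `D_c S = S` reads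
`S_n(c x) = ψ(c)^{n/2} S_n(x) = c^{-nΔ} S_n(x)` with `Δ = -e/2 ≥ 0`. [folklore] -/
theorem isScaleCovariant_of_clusterSetTotallyDisconnected (htd : ClusterRigidity.ClusterSetTotallyDisconnected) :
    ∀ S ∈ {S : CorrFamily 3 | (∀ n x, x ∉ NonCoincident 3 n → S n x = 0) ∧
      ∃ u : ℕ → ℝ, (∀ k, u k ∈ Set.Ioc (0:ℝ) 1) ∧ Filter.Tendsto u Filter.atTop (nhds 0) ∧ ∀ n, TendstoLocallyUniformlyOn
        (fun k => rescaledCorrelator (criticalCorr 3) (fun δ : ℝ => (criticalTwoPoint 3 (Pi.single 0 ⌊δ⁻¹⌋)) ^ (-(1/2:ℝ))) n (u k))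
        (S n) Filter.atTop (NonCoincident 3 n)},
      ∃ Δ : ℝ, 0 ≤ Δ ∧ IsScaleCovariant Δ S := by
  intro S hS
  have hcp : IsClusterPoint S := isClusterPoint_of_mem_clusterSet hS
  have hfix := fun {c : ℝ} (hc : 0 < c) => dilate_pin_eq_self_of_clusterSetTotallyDisconnected htd hS hc
  set ψ : ℝ → ℝ := fun s => S 2 (![0, EuclideanSpace.single 0 s] : Fin 2 → EuclideanSpace ℝ (Fin 3)) with hψ
  have hψpos : ∀ s, 0 < s → 0 < ψ s := fun s hs =>
    clusterPoint_nondeg_two (clusterPoint_two_conv hcp) _ (cfg0_mem hs.ne')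
  have hψcont : ContinuousOn ψ (Set.Ioi 0) := by
    have h := (continuousOn_of_isClusterPoint hcp 2).comp
      (continuous_smul_cfg (![0, EuclideanSpace.single 0 1] : Fin 2 → EuclideanSpace ℝ (Fin 3))).continuousOn
      (fun s (hs : s ∈ Set.Ioi (0:ℝ)) => smul_mapsTo_nonCoincident_sc (ne_of_gt hs) 2 cfg01_mem)
    refine h.congr fun s _ => ?_
    simp only [hψ, Function.comp_apply, smul_cfg01]
  -- the fixed-point identity at order `n`, configuration `x`, dilation `c`
  have hid : ∀ {c : ℝ}, 0 < c → ∀ (n : ℕ) (x : Fin n → EuclideanSpace ℝ (Fin 3)),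
      (ψ c) ^ (-(n:ℝ) / 2) * S n (fun i => c • x i) = S n x := by
    intro c hc n x
    have h := hfix hc
    exact congr_fun (congr_fun h n) x
  -- multiplicativity of the axis profile
  have hψmul : ∀ a b, 0 < a → 0 < b → ψ (a * b) = ψ a * ψ b := by
    intro a b ha hb
    have h := hid ha 2 (![0, EuclideanSpace.single 0 b] : Fin 2 → EuclideanSpace ℝ (Fin 3))
    rw [smul_cfg0] at h
    have hexp : (-((2:ℕ):ℝ) / 2) = -1 := by norm_num
    rw [hexp, Real.rpow_neg_one] at h
    have hane : ψ a ≠ 0 := (hψpos a ha).ne'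
    calc ψ (a * b) = ψ a * ((ψ a)⁻¹ * ψ (a * b)) := by rw [← mul_assoc, mul_inv_cancel₀ hane, one_mul]
      _ = ψ a * ψ b := by rw [h]
  obtain ⟨e, he⟩ := exists_rpow_of_mul_of_continuousOn hψpos hψcont hψmul
  -- `e ≤ 0`: the profile is `≤ 1` beyond the pinned pair (limit of `pz_two_cfg0_le_one`)
  have he0 : e ≤ 0 := by
    have hψ2 : ψ 2 ≤ 1 := by
      obtain ⟨u, hu1, hu, hconv⟩ := exists_seq_Ioc_of_isClusterPoint hcp
      have ht : Tendsto (fun k => rescaledCorrelator (criticalCorr 3) rhoPin 2 (u k)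
          (![0, EuclideanSpace.single 0 2] : Fin 2 → EuclideanSpace ℝ (Fin 3))) atTop (𝓝 (ψ 2)) :=
        (hconv 2).tendsto_at (cfg0_mem two_ne_zero)
      exact le_of_tendsto' ht fun k => pz_two_cfg0_le_one (hu1 k).1 one_le_two
    refine le_of_not_gt fun hpos => ?_
    have h2 : (1:ℝ) < (2:ℝ) ^ e := Real.one_lt_rpow one_lt_two hpos
    rw [← he 2 two_pos] at h2
    linarith
  refine ⟨-e / 2, by linarith, fun n c hc x => ?_⟩
  have h := hid hc n x
  rw [show ψ c = c ^ e from he c hc, ← Real.rpow_mul hc.le] at h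
  have hA : 0 < c ^ (e * (-(n:ℝ) / 2)) := Real.rpow_pos_of_pos hc _
  have hexp : -(n:ℝ) * (-e / 2) = -(e * (-(n:ℝ) / 2)) := by ring
  calc S n (fun i => c • x i) = (c ^ (e * (-(n:ℝ) / 2)))⁻¹ * ((c ^ (e * (-(n:ℝ) / 2))) * S n (fun i => c • x i)) := by
        rw [← mul_assoc, inv_mul_cancel₀ hA.ne', one_mul]
    _ = c ^ (-(n : ℝ) * (-e / 2)) * S n x := by rw [h, hexp, Real.rpow_neg hc.le]

/-- **Under item 4659 every cluster point satisfies every clause the crux asks of its limit, except being THE full-filter limit**: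
normalised, non-degenerate two-point function (`clusterPoint_nondeg_two`, unconditional), translation invariant
(`seqLimit_translate`, unconditional) and exactly scale covariant with some `Δ ≥ 0`
(`isScaleCovariant_of_clusterSetTotallyDisconnected`). [folklore] -/
theorem cruxClauses_of_clusterSetTotallyDisconnected (htd : ClusterRigidity.ClusterSetTotallyDisconnected) :
    ∀ S ∈ {S : CorrFamily 3 | (∀ n x, x ∉ NonCoincident 3 n → S n x = 0) ∧
      ∃ u : ℕ → ℝ, (∀ k, u k ∈ Set.Ioc (0:ℝ) 1) ∧ Filter.Tendsto u Filter.atTop (nhds 0) ∧ ∀ n, TendstoLocallyUniformlyOn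
        (fun k => rescaledCorrelator (criticalCorr 3) (fun δ : ℝ => (criticalTwoPoint 3 (Pi.single 0 ⌊δ⁻¹⌋)) ^ (-(1/2:ℝ))) n (u k))
        (S n) Filter.atTop (NonCoincident 3 n)},
      (∀ n z, z ∉ NonCoincident 3 n → S n z = 0) ∧ IsNondegenerateTwoPoint S ∧ IsTranslationInvariant S ∧
        ∃ Δ : ℝ, 0 ≤ Δ ∧ IsScaleCovariant Δ S := by
  intro S hS
  have hcp : IsClusterPoint S := isClusterPoint_of_mem_clusterSet hS
  refine ⟨hS.1, clusterPoint_nondeg_two (clusterPoint_two_conv hcp), ?_, isScaleCovariant_of_clusterSetTotallyDisconnected htd S hS⟩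
  obtain ⟨u, hu, hconv⟩ := hcp
  intro n v x
  by_cases hx : x ∈ NonCoincident 3 n
  · exact seqLimit_translate hu (hconv n) v hx
  · have hx' : (fun i => x i + v) ∉ NonCoincident 3 n := by
      intro h
      apply hx
      rw [mem_nonCoincident] at h ⊢
      intro i j hij
      exact h (by simp [hij])
    rw [hS.1 n _ hx', hS.1 n x hx]

end Summit.CriticalPhenomena.Ising3DConformalLimit.Cruxes.ExistsScaleCovariantLimit.FoldedCurrentRepulsion

end
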